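import Summits.Ventures.Crystal3D.Bulk.L2bFrames
import Literature.Geometry.DiscreteGeometry.LayerShellPatterns
import HarnessLib

/-!
# L2B, file 5: the radius-2 patch of an adapted frame is a piece of a Barlow stacking

HONEST FRAMING. Part of the venture `Summits/Ventures/Crystal3D` (cell `pub-crystal3d`, phase 2), a brick
of the radius-2 lemma `RadiusTwoBarlow` (`Bulk/PositionalOrder.lean`; design `HOME/lean/l2b/DESIGN.md`).
Elementary geometry in Hales's normalisation (`kissingShell`, contact distance `2`, stacking
`barlowStacking 2 (2√(2/3)) s` of `Literature/…/BarlowStacking.lean`); no definition, no notation.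

## Contents (namespace `Summit.Ventures.Crystal3D.L2B`)

In a frame as produced by `exists_adapted_frame` of `RadiusTwoBarlowHolds.lean` — which imports THIS file —
(`0 ∈ V` with shell `layerShell σ σ'`, the six
hexagon balls with the same shell, every neighbour with an FCC/HCP tangent arrangement):
* `upper_shell`, `lower_shell` — a polar ball `t` (`t ∓ h e₃` a hole point) has the standard hexagon in
  its shell (its in-layer neighbours are polar balls of the hexagon balls), hence a layer shell, whose
  type towards the centre's layer is forced;
* `upper_shells`, `lower_shells` — the three upper (lower) polar balls have one common outer type
  (adjacent balls of a layer carry hole triples of the same type);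
* **`patch_subset_barlowStacking`** — with the Hägg word `s(−2), s(−1), s(0), s(1) = −ρ′, −σ′, σ, ρ`
  the centre, its twelve neighbours and all their neighbours lie in `barlowStacking 2 (2√(2/3)) s`
  (tree lemma `kissingShell_barlowStacking_eq_layerShell`: the tangent arrangement of a stacking point
  of layer `k` is `layerShell (s k) (−s (k−1))`).
-/

noncomputable section

namespace Summit.Ventures.Crystal3D.L2B

open Literature.Geometry.DiscreteGeometry Literature.MathematicalPhysics.StatisticalMechanics
open RealInnerProductSpace

variable {V : Set (EuclideanSpace ℝ (Fin 3))}

/-! ## Polar shells -/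

/-- **Upper polar shell.** In an adapted frame, a ball `t` with `t − h e₃ ∈ holeTriple σ` has shell
`layerShell ρ (−σ)` for some sign `ρ`. -/
theorem upper_shell (hV : IsUnitBallPacking V) (h0 : (0 : EuclideanSpace ℝ (Fin 3)) ∈ V) {σ σ' : ℝ}
    (hσ : σ = 1 ∨ σ = -1) (hS0 : kissingShell V 0 = layerShell σ σ')
    (hring : ∀ η ∈ hexagonSet, kissingShell V η = layerShell σ σ')
    (hcp1 : ∀ c ∈ kissingShell V 0, IsArrangedIn (kissingShell V c) fccKissingPattern ∨
      IsArrangedIn (kissingShell V c) hcpKissingPattern)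
    {t : EuclideanSpace ℝ (Fin 3)} (ht : t - layerNormal layerSpacing ∈ holeTriple σ) :
    ∃ ρ : ℝ, (ρ = 1 ∨ ρ = -1) ∧ kissingShell V t = layerShell ρ (-σ) := by
  have htS : t ∈ kissingShell V 0 := hS0 ▸ mem_layerShell_iff.2 (Or.inr (Or.inl ht))
  have ht2 : t 2 = layerSpacing := by
    have := apply_two_of_mem_holeTriple ht
    simp only [PiLp.sub_apply, frameE_apply_two] at this; linarith
  have hH : hexagonSet ⊆ kissingShell V t := by
    intro ζ hζ
    have hζt : t ∈ kissingShell V ζ := by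
      rw [hring ζ hζ]; exact mem_layerShell_iff.2 (Or.inr (Or.inl ht))
    exact ⟨by rw [add_comm]; exact hζt.1, norm_of_mem_hexagonSet hζ⟩
  obtain ⟨ρ, ρ', hρ, hρ', hSt⟩ :=
    (isTwelveConfig_kissingShell_of_isArrangedIn hV (hcp1 t htS)).eq_layerShell hH
  have hneg : -t ∈ kissingShell V t := ⟨by simpa using h0, by rw [norm_neg]; exact htS.2⟩
  rw [hSt] at hneg
  have hρ'σ : ρ' = -σ := by
    rcases mem_layerShell_iff.1 hneg with h | h | h
    · have := apply_two_of_mem_hexagonSet h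
      simp only [PiLp.neg_apply, ht2] at this; linarith [layerSpacing_pos]
    · have := apply_two_of_mem_holeTriple h
      simp only [PiLp.sub_apply, PiLp.neg_apply, ht2, frameE_apply_two] at this
      linarith [layerSpacing_pos]
    · have h' : -t + layerNormal layerSpacing ∈ holeTriple (-σ) := by
        rw [show -t + layerNormal layerSpacing = -(t - layerNormal layerSpacing) by abel,
          neg_mem_holeTriple_iff, neg_neg]
        exact ht
      by_contra hne
      have hρ's : ρ' = σ := by
        rcases hρ' with rfl | rfl <;> rcases hσ with rfl | rfl <;>
          [rfl; exact absurd (by norm_num) hne; exact absurd (by norm_num) hne; rfl]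
      rw [hρ's] at h
      exact not_mem_holeTriple_neg hσ h h'
  exact ⟨ρ, hρ, by rw [hSt, hρ'σ]⟩

/-- **Lower polar shell.** In an adapted frame, a ball `t` with `t + h e₃ ∈ holeTriple σ'` has shell
`layerShell (−σ') ρ'` for some sign `ρ'`. -/
theorem lower_shell (hV : IsUnitBallPacking V) (h0 : (0 : EuclideanSpace ℝ (Fin 3)) ∈ V) {σ σ' : ℝ}
    (hσ' : σ' = 1 ∨ σ' = -1) (hS0 : kissingShell V 0 = layerShell σ σ')
    (hring : ∀ η ∈ hexagonSet, kissingShell V η = layerShell σ σ')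
    (hcp1 : ∀ c ∈ kissingShell V 0, IsArrangedIn (kissingShell V c) fccKissingPattern ∨
      IsArrangedIn (kissingShell V c) hcpKissingPattern)
    {t : EuclideanSpace ℝ (Fin 3)} (ht : t + layerNormal layerSpacing ∈ holeTriple σ') :
    ∃ ρ' : ℝ, (ρ' = 1 ∨ ρ' = -1) ∧ kissingShell V t = layerShell (-σ') ρ' := by
  have htS : t ∈ kissingShell V 0 := hS0 ▸ mem_layerShell_iff.2 (Or.inr (Or.inr ht))
  have ht2 : t 2 = -layerSpacing := by
    have := apply_two_of_mem_holeTriple ht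
    simp only [PiLp.add_apply, frameE_apply_two] at this; linarith
  have hH : hexagonSet ⊆ kissingShell V t := by
    intro ζ hζ
    have hζt : t ∈ kissingShell V ζ := by
      rw [hring ζ hζ]; exact mem_layerShell_iff.2 (Or.inr (Or.inr ht))
    exact ⟨by rw [add_comm]; exact hζt.1, norm_of_mem_hexagonSet hζ⟩
  obtain ⟨ρ, ρ', hρ, hρ', hSt⟩ :=
    (isTwelveConfig_kissingShell_of_isArrangedIn hV (hcp1 t htS)).eq_layerShell hH
  have hneg : -t ∈ kissingShell V t := ⟨by simpa using h0, by rw [norm_neg]; exact htS.2⟩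
  rw [hSt] at hneg
  have hρσ : ρ = -σ' := by
    rcases mem_layerShell_iff.1 hneg with h | h | h
    · have := apply_two_of_mem_hexagonSet h
      simp only [PiLp.neg_apply, ht2] at this; linarith [layerSpacing_pos]
    · have h' : -t - layerNormal layerSpacing ∈ holeTriple (-σ') := by
        rw [show -t - layerNormal layerSpacing = -(t + layerNormal layerSpacing) by abel,
          neg_mem_holeTriple_iff, neg_neg]
        exact ht
      by_contra hne
      have hρs : ρ = σ' := by
        rcases hρ with rfl | rfl <;> rcases hσ' with rfl | rfl <;>
          [rfl; exact absurd (by norm_num) hne; exact absurd (by norm_num) hne; rfl]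
      rw [hρs] at h
      exact not_mem_holeTriple_neg hσ' h h'
    · have := apply_two_of_mem_holeTriple h
      simp only [PiLp.add_apply, PiLp.neg_apply, ht2, frameE_apply_two] at this
      linarith [layerSpacing_pos]
  exact ⟨ρ', hρ', by rw [hSt, hρσ]⟩

/-- **The three upper polar balls have a common outer type.** -/
theorem upper_shells (hV : IsUnitBallPacking V) (h0 : (0 : EuclideanSpace ℝ (Fin 3)) ∈ V) {σ σ' : ℝ}
    (hσ : σ = 1 ∨ σ = -1) (hS0 : kissingShell V 0 = layerShell σ σ')
    (hring : ∀ η ∈ hexagonSet, kissingShell V η = layerShell σ σ')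
    (hcp1 : ∀ c ∈ kissingShell V 0, IsArrangedIn (kissingShell V c) fccKissingPattern ∨
      IsArrangedIn (kissingShell V c) hcpKissingPattern) :
    ∃ ρ : ℝ, (ρ = 1 ∨ ρ = -1) ∧ ∀ t : EuclideanSpace ℝ (Fin 3),
      t - layerNormal layerSpacing ∈ holeTriple σ → kissingShell V t = layerShell ρ (-σ) := by
  have hmσ : (-σ = 1 ∨ -σ = -1) := by rcases hσ with rfl | rfl <;> norm_num
  -- the three balls
  have m1 : σ • barlowOffset (2 : ℝ) + layerNormal layerSpacing - layerNormal layerSpacing ∈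
      holeTriple σ := by simp [holeTriple]
  have m2 : σ • (barlowOffset (2 : ℝ) - triangularVec₁ (2 : ℝ)) + layerNormal layerSpacing -
      layerNormal layerSpacing ∈ holeTriple σ := by simp [holeTriple]
  have m3 : σ • (barlowOffset (2 : ℝ) - triangularVec₂ (2 : ℝ)) + layerNormal layerSpacing -
      layerNormal layerSpacing ∈ holeTriple σ := by simp [holeTriple]
  obtain ⟨ρ₁, hρ₁, hS₁⟩ := upper_shell hV h0 hσ hS0 hring hcp1 m1
  obtain ⟨ρ₂, hρ₂, hS₂⟩ := upper_shell hV h0 hσ hS0 hring hcp1 m2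
  obtain ⟨ρ₃, hρ₃, hS₃⟩ := upper_shell hV h0 hσ hS0 hring hcp1 m3
  have e2 : ρ₂ = ρ₁ := by
    rcases hσ with rfl | rfl
    · have h := hS₁
      rw [show (1 : ℝ) • barlowOffset (2 : ℝ) + layerNormal layerSpacing =
        (1 : ℝ) • (barlowOffset (2 : ℝ) - triangularVec₁ (2 : ℝ)) + layerNormal layerSpacing +
          triangularVec₁ (2 : ℝ) by module] at h
      exact ((types_eq_of_adjacent hV (Or.inl rfl) hρ₂ hmσ hρ₁ hmσ hS₂ h).1).symm
    · have h := hS₂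
      rw [show (-1 : ℝ) • (barlowOffset (2 : ℝ) - triangularVec₁ (2 : ℝ)) + layerNormal layerSpacing =
        (-1 : ℝ) • barlowOffset (2 : ℝ) + layerNormal layerSpacing + triangularVec₁ (2 : ℝ) by module] at h
      exact (types_eq_of_adjacent hV (Or.inl rfl) hρ₁ hmσ hρ₂ hmσ hS₁ h).1
  have e3 : ρ₃ = ρ₁ := by
    rcases hσ with rfl | rfl
    · have h := hS₁
      rw [show (1 : ℝ) • barlowOffset (2 : ℝ) + layerNormal layerSpacing =
        (1 : ℝ) • (barlowOffset (2 : ℝ) - triangularVec₂ (2 : ℝ)) + layerNormal layerSpacing +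
          triangularVec₂ (2 : ℝ) by module] at h
      exact ((types_eq_of_adjacent hV (Or.inr rfl) hρ₃ hmσ hρ₁ hmσ hS₃ h).1).symm
    · have h := hS₃
      rw [show (-1 : ℝ) • (barlowOffset (2 : ℝ) - triangularVec₂ (2 : ℝ)) + layerNormal layerSpacing =
        (-1 : ℝ) • barlowOffset (2 : ℝ) + layerNormal layerSpacing + triangularVec₂ (2 : ℝ) by module] at h
      exact (types_eq_of_adjacent hV (Or.inr rfl) hρ₁ hmσ hρ₃ hmσ hS₁ h).1
  rw [e2] at hS₂
  rw [e3] at hS₃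
  refine ⟨ρ₁, hρ₁, fun t ht => ?_⟩
  simp only [holeTriple, Set.mem_insert_iff, Set.mem_singleton_iff] at ht
  rcases ht with h | h | h
  · have ht' : t = σ • barlowOffset (2 : ℝ) + layerNormal layerSpacing := by rw [← h]; abel
    rw [ht']; exact hS₁
  · have ht' : t = σ • (barlowOffset (2 : ℝ) - triangularVec₁ (2 : ℝ)) + layerNormal layerSpacing := by
      rw [← h]; abel
    rw [ht']; exact hS₂
  · have ht' : t = σ • (barlowOffset (2 : ℝ) - triangularVec₂ (2 : ℝ)) + layerNormal layerSpacing := by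
      rw [← h]; abel
    rw [ht']; exact hS₃

/-- **The three lower polar balls have a common outer type.** -/
theorem lower_shells (hV : IsUnitBallPacking V) (h0 : (0 : EuclideanSpace ℝ (Fin 3)) ∈ V) {σ σ' : ℝ}
    (hσ' : σ' = 1 ∨ σ' = -1) (hS0 : kissingShell V 0 = layerShell σ σ')
    (hring : ∀ η ∈ hexagonSet, kissingShell V η = layerShell σ σ')
    (hcp1 : ∀ c ∈ kissingShell V 0, IsArrangedIn (kissingShell V c) fccKissingPattern ∨
      IsArrangedIn (kissingShell V c) hcpKissingPattern) :
    ∃ ρ' : ℝ, (ρ' = 1 ∨ ρ' = -1) ∧ ∀ t : EuclideanSpace ℝ (Fin 3),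
      t + layerNormal layerSpacing ∈ holeTriple σ' → kissingShell V t = layerShell (-σ') ρ' := by
  have hmσ : (-σ' = 1 ∨ -σ' = -1) := by rcases hσ' with rfl | rfl <;> norm_num
  have m1 : σ' • barlowOffset (2 : ℝ) - layerNormal layerSpacing + layerNormal layerSpacing ∈
      holeTriple σ' := by simp [holeTriple]
  have m2 : σ' • (barlowOffset (2 : ℝ) - triangularVec₁ (2 : ℝ)) - layerNormal layerSpacing +
      layerNormal layerSpacing ∈ holeTriple σ' := by simp [holeTriple]
  have m3 : σ' • (barlowOffset (2 : ℝ) - triangularVec₂ (2 : ℝ)) - layerNormal layerSpacing +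
      layerNormal layerSpacing ∈ holeTriple σ' := by simp [holeTriple]
  obtain ⟨ρ₁, hρ₁, hS₁⟩ := lower_shell hV h0 hσ' hS0 hring hcp1 m1
  obtain ⟨ρ₂, hρ₂, hS₂⟩ := lower_shell hV h0 hσ' hS0 hring hcp1 m2
  obtain ⟨ρ₃, hρ₃, hS₃⟩ := lower_shell hV h0 hσ' hS0 hring hcp1 m3
  have e2 : ρ₂ = ρ₁ := by
    rcases hσ' with rfl | rfl
    · have h := hS₁
      rw [show (1 : ℝ) • barlowOffset (2 : ℝ) - layerNormal layerSpacing =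
        (1 : ℝ) • (barlowOffset (2 : ℝ) - triangularVec₁ (2 : ℝ)) - layerNormal layerSpacing +
          triangularVec₁ (2 : ℝ) by module] at h
      exact ((types_eq_of_adjacent hV (Or.inl rfl) hmσ hρ₂ hmσ hρ₁ hS₂ h).2).symm
    · have h := hS₂
      rw [show (-1 : ℝ) • (barlowOffset (2 : ℝ) - triangularVec₁ (2 : ℝ)) - layerNormal layerSpacing =
        (-1 : ℝ) • barlowOffset (2 : ℝ) - layerNormal layerSpacing + triangularVec₁ (2 : ℝ) by module] at h
      exact (types_eq_of_adjacent hV (Or.inl rfl) hmσ hρ₁ hmσ hρ₂ hS₁ h).2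
  have e3 : ρ₃ = ρ₁ := by
    rcases hσ' with rfl | rfl
    · have h := hS₁
      rw [show (1 : ℝ) • barlowOffset (2 : ℝ) - layerNormal layerSpacing =
        (1 : ℝ) • (barlowOffset (2 : ℝ) - triangularVec₂ (2 : ℝ)) - layerNormal layerSpacing +
          triangularVec₂ (2 : ℝ) by module] at h
      exact ((types_eq_of_adjacent hV (Or.inr rfl) hmσ hρ₃ hmσ hρ₁ hS₃ h).2).symm
    · have h := hS₃
      rw [show (-1 : ℝ) • (barlowOffset (2 : ℝ) - triangularVec₂ (2 : ℝ)) - layerNormal layerSpacing =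
        (-1 : ℝ) • barlowOffset (2 : ℝ) - layerNormal layerSpacing + triangularVec₂ (2 : ℝ) by module] at h
      exact (types_eq_of_adjacent hV (Or.inr rfl) hmσ hρ₁ hmσ hρ₃ hS₁ h).2
  rw [e2] at hS₂
  rw [e3] at hS₃
  refine ⟨ρ₁, hρ₁, fun t ht => ?_⟩
  simp only [holeTriple, Set.mem_insert_iff, Set.mem_singleton_iff] at ht
  rcases ht with h | h | h
  · have ht' : t = σ' • barlowOffset (2 : ℝ) - layerNormal layerSpacing := by rw [← h]; abel
    rw [ht']; exact hS₁
  · have ht' : t = σ' • (barlowOffset (2 : ℝ) - triangularVec₁ (2 : ℝ)) - layerNormal layerSpacing := by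
      rw [← h]; abel
    rw [ht']; exact hS₂
  · have ht' : t = σ' • (barlowOffset (2 : ℝ) - triangularVec₂ (2 : ℝ)) - layerNormal layerSpacing := by
      rw [← h]; abel
    rw [ht']; exact hS₃

/-! ## The Barlow stacking through the patch -/

/-- A real sign is an integer sign. -/
theorem exists_int_sign {a : ℝ} (ha : a = 1 ∨ a = -1) : ∃ n : ℤ, (n = 1 ∨ n = -1) ∧ (n : ℝ) = a := by
  rcases ha with rfl | rfl
  · exact ⟨1, Or.inl rfl, by simp⟩
  · exact ⟨-1, Or.inr rfl, by simp⟩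

/-- **The radius-2 patch lies in a Barlow stacking.** In an adapted frame (`0 ∈ V` with shell
`layerShell σ σ'`, the six hexagon balls with the same shell, every neighbour of `0` with an FCC or HCP
tangent arrangement) there is a Hägg sequence `s` such that `0`, every neighbour `c` of `0`, and every
neighbour `c + y` of such a `c` lie in `barlowStacking 2 (2√(2/3)) s`. -/
theorem patch_subset_barlowStacking (hV : IsUnitBallPacking V) (h0 : (0 : EuclideanSpace ℝ (Fin 3)) ∈ V)
    {σ σ' : ℝ} (hσ : σ = 1 ∨ σ = -1) (hσ' : σ' = 1 ∨ σ' = -1)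
    (hS0 : kissingShell V 0 = layerShell σ σ')
    (hring : ∀ η ∈ hexagonSet, kissingShell V η = layerShell σ σ')
    (hcp1 : ∀ c ∈ kissingShell V 0, IsArrangedIn (kissingShell V c) fccKissingPattern ∨
      IsArrangedIn (kissingShell V c) hcpKissingPattern) :
    ∃ s : ℤ → ℤ, IsHaggSeq s ∧ ∀ z : EuclideanSpace ℝ (Fin 3),
      (z = 0 ∨ z ∈ kissingShell V 0 ∨ ∃ c ∈ kissingShell V 0, z - c ∈ kissingShell V c) →
        z ∈ barlowStacking 2 layerSpacing s := by
  obtain ⟨ρ, hρ, hU⟩ := upper_shells hV h0 hσ hS0 hring hcp1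
  obtain ⟨ρ', hρ', hD⟩ := lower_shells hV h0 hσ' hS0 hring hcp1
  obtain ⟨nσ, hnσ, eσ⟩ := exists_int_sign hσ
  obtain ⟨nσ', hnσ', eσ'⟩ := exists_int_sign hσ'
  obtain ⟨nρ, hnρ, eρ⟩ := exists_int_sign hρ
  obtain ⟨nρ', hnρ', eρ'⟩ := exists_int_sign hρ'
  -- the Hägg word through layers -2 … 2
  set s : ℤ → ℤ := fun k =>
    if k = 0 then nσ else if k = 1 then nρ else if k = -1 then -nσ' else if k = -2 then -nρ' else 1
    with hs_def
  have s0 : s 0 = nσ := by simp [hs_def]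
  have s1 : s 1 = nρ := by simp [hs_def]
  have sm1 : s (-1) = -nσ' := by simp [hs_def]
  have sm2 : s (-2) = -nρ' := by simp [hs_def]
  have hs : IsHaggSeq s := by
    intro k
    simp only [hs_def]
    split_ifs
    · exact hnσ
    · exact hnρ
    · rcases hnσ' with h | h <;> simp [h]
    · rcases hnρ' with h | h <;> simp [h]
    · exact Or.inl rfl
  have L0 : (haggLabel s 0 : ℝ) = 0 := by simp
  have L1 : (haggLabel s 1 : ℝ) = σ := by
    have h := haggLabel_succ s 0
    rw [zero_add, haggLabel_zero, zero_add, s0] at h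
    rw [h, eσ]
  have Lm1 : (haggLabel s (-1) : ℝ) = σ' := by
    have h := haggLabel_succ s (-1)
    rw [show (-1 : ℤ) + 1 = 0 by norm_num, haggLabel_zero, sm1] at h
    have h' : haggLabel s (-1) = nσ' := by linarith
    rw [h', eσ']
  -- a stacking point with the right shell carries its neighbours into the stacking
  have centre : ∀ (k i j : ℤ) (c : EuclideanSpace ℝ (Fin 3)), c = barlowPos 2 layerSpacing s k i j →
      kissingShell V c = layerShell (s k : ℝ) (-(s (k - 1) : ℝ)) →
      c ∈ barlowStacking 2 layerSpacing s ∧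
        ∀ y ∈ kissingShell V c, c + y ∈ barlowStacking 2 layerSpacing s := by
    intro k i j c hc hSc
    subst hc
    refine ⟨barlowPos_mem _ _ _, fun y hy => ?_⟩
    rw [hSc, ← kissingShell_barlowStacking_eq_layerShell hs k i j] at hy
    exact hy.1
  have hpos : ∀ k i j : ℤ, barlowPos 2 layerSpacing s k i j =
      (i : ℝ) • triangularVec₁ (2 : ℝ) + (j : ℝ) • triangularVec₂ (2 : ℝ) +
        (haggLabel s k : ℝ) • barlowOffset (2 : ℝ) + (k : ℝ) • layerNormal layerSpacing := fun _ _ _ => rfl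
  -- the centre
  have c0 : (0 : EuclideanSpace ℝ (Fin 3)) = barlowPos 2 layerSpacing s 0 0 0 := by
    rw [hpos]; simp
  have t0 : kissingShell V 0 = layerShell (s 0 : ℝ) (-(s (0 - 1) : ℝ)) := by
    rw [hS0, show (0 : ℤ) - 1 = -1 by norm_num, s0, sm1, eσ]; push_cast; rw [eσ', neg_neg]
  -- the hexagon balls
  have chex : ∀ η ∈ hexagonSet, ∃ i j : ℤ, η = barlowPos 2 layerSpacing s 0 i j := by
    intro η hη
    simp only [hexagonSet, Set.mem_insert_iff, Set.mem_singleton_iff] at hη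
    rcases hη with rfl | rfl | rfl | rfl | rfl | rfl
    · exact ⟨1, 0, by rw [hpos]; simp⟩
    · exact ⟨-1, 0, by rw [hpos]; simp⟩
    · exact ⟨0, 1, by rw [hpos]; simp⟩
    · exact ⟨0, -1, by rw [hpos]; simp⟩
    · exact ⟨1, -1, by rw [hpos]; simp [sub_eq_add_neg]⟩
    · exact ⟨-1, 1, by rw [hpos]; simp [sub_eq_add_neg]; abel⟩
  -- the upper polar balls
  have cup : ∀ t : EuclideanSpace ℝ (Fin 3), t - layerNormal layerSpacing ∈ holeTriple σ →
      ∃ i j : ℤ, t = barlowPos 2 layerSpacing s 1 i j := by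
    intro t ht
    have e : t = (t - layerNormal layerSpacing) + layerNormal layerSpacing := by abel
    simp only [holeTriple, Set.mem_insert_iff, Set.mem_singleton_iff] at ht
    rcases ht with h | h | h
    · exact ⟨0, 0, by rw [e, h, hpos, L1]; simp⟩
    · exact ⟨-nσ, 0, by rw [e, h, hpos, L1]; push_cast; rw [eσ]; simp; module⟩
    · exact ⟨0, -nσ, by rw [e, h, hpos, L1]; push_cast; rw [eσ]; simp; module⟩
  have tup : layerShell ρ (-σ) = layerShell (s 1 : ℝ) (-(s (1 - 1) : ℝ)) := by
    rw [show (1 : ℤ) - 1 = 0 by norm_num, s1, s0, eρ, eσ]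
  -- the lower polar balls
  have cdown : ∀ t : EuclideanSpace ℝ (Fin 3), t + layerNormal layerSpacing ∈ holeTriple σ' →
      ∃ i j : ℤ, t = barlowPos 2 layerSpacing s (-1) i j := by
    intro t ht
    have e : t = (t + layerNormal layerSpacing) - layerNormal layerSpacing := by abel
    simp only [holeTriple, Set.mem_insert_iff, Set.mem_singleton_iff] at ht
    rcases ht with h | h | h
    · exact ⟨0, 0, by rw [e, h, hpos, Lm1]; simp [sub_eq_add_neg]⟩
    · exact ⟨-nσ', 0, by rw [e, h, hpos, Lm1]; push_cast; rw [eσ']; simp [sub_eq_add_neg]; module⟩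
    · exact ⟨0, -nσ', by rw [e, h, hpos, Lm1]; push_cast; rw [eσ']; simp [sub_eq_add_neg]; module⟩
  have tdown : layerShell (-σ') ρ' = layerShell (s (-1) : ℝ) (-(s (-1 - 1) : ℝ)) := by
    rw [show (-1 : ℤ) - 1 = -2 by norm_num, sm1, sm2]; push_cast; rw [eσ', eρ', neg_neg]
  -- assembly
  refine ⟨s, hs, fun z hz => ?_⟩
  rcases hz with rfl | hz | ⟨c, hc, hzc⟩
  · exact (centre 0 0 0 0 c0 t0).1
  · have h := (centre 0 0 0 0 c0 t0).2 z hz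
    rwa [zero_add] at h
  · have hc' := hc
    rw [hS0] at hc'
    rcases mem_layerShell_iff.1 hc' with h | h | h
    · obtain ⟨i, j, hcp⟩ := chex c h
      have := (centre 0 i j c hcp (by rw [hring c h]; exact t0 ▸ hS0 ▸ rfl)).2 (z - c) hzc
      rwa [add_sub_cancel] at this
    · obtain ⟨i, j, hcp⟩ := cup c h
      have := (centre 1 i j c hcp (by rw [hU c h, tup])).2 (z - c) hzc
      rwa [add_sub_cancel] at this
    · obtain ⟨i, j, hcp⟩ := cdown c h
      have := (centre (-1) i j c hcp (by rw [hD c h, tdown])).2 (z - c) hzc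
      rwa [add_sub_cancel] at this

end Summit.Ventures.Crystal3D.L2B
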